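import Summits.CriticalPhenomena.PercolationContinuityZ3.Theorems.Transplant.SkelPhiSeedKit
import Summits.CriticalPhenomena.PercolationContinuityZ3.Theorems.Transplant.SkelPhiRectAt
import Summits.CriticalPhenomena.PercolationContinuityZ3.Theorems.Transplant.SkelSeedSlabDeep
import HarnessLib

/-!
# D″ node, φ-level generic layer ((B″), V98 p1 column): the GEOMETRY OF THE DEEP SEED SLAB of a window level for a bare planar map
# `φ : V → ℤ²` — contact exit data, inward and straight `step`-walks, the tangential path and the deep slab centre — φ-level re-cut of
# `SkelSeedSlab` §5 (p234423: `exists_coord_eq_of_contact`, `exitDir`), `SkelSeedSlabIn` §1 (p235569: `inward`) and `SkelSeedSlabDeep` §1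
# (p236402: `walk`, `pathPt`, `deepCtr`), the v3 design of record (deep slab, `T₀ = 2ℓs + 2 + M`)

builds on p205010 (kernel theorem, internal audit signed; external expert review pending) — nothing in this file uses p205010.
Lane `prim-bschramm`, seat `prim-bschramm-p1` (gen 9); helper file (`--supports stmt-CriticalPhenomena-4575 --as helper`).

For a candidate contact `x` of the window level over the planar box `Icc Lo Hi` with inner neighbour `y = Skelφ.inNbr G φ w₀ R (Icc Lo Hi) x`
(`φ y ∈ Icc Lo Hi`, on the boundary layer: `exists_coord_eq_of_contact`, from `Lip`), the EXIT DATUM `(i₀, σ) = exitDir` (face coordinate and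
outward sign), the INWARD STEP `inward` (one `step` off the face), the STRAIGHT `step`-WALKS `walk i s v k` (`φ` moves by `k s e_i`), the
tangential PATH `pathPt k = walk i₁ s (inward y) k` (`i₁ = oth i₀`, `k ≤ pathLen = |τ − φ y i₁|`, `τ = SkelI.tanTgt` the clamped tangential
target at depth `T₀ = SkelI.tanOff ℓs M`) and the DEEP SLAB CENTRE `deepCtr` over `SkelI.deepPt` (exit coordinate `φ y i₀ − σ(ℓs+1)`,
tangential coordinate `τ`), reached by outward unit steps (p3-g7's `Skelφ.exists_mem_graphBall_φ_eq`, `SkelPhiRectAt` §1, from `Steps`).  All CHOICES are made from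
existential statements about `φ` alone, so the constants carry neither a structure nor a `DecidableEq` instance nor a proof; the
hypotheses `hlip : Skelφ.Lip G φ` / `hstep : Skelφ.Steps G φ` enter only the specification theorems.  The planar gadgets `SkelI.slabPt`,
`SkelI.tanOff/tanTgt/tanSign/deepPt` (+ lemmas) and `oth` are Φ-free and IMPORTED.
* §1 `walk`, `walk_adj`, `φ_walk`, `walk_mem_graphBall`, `colPt`/`colPt_spec` (the column vertex over a planar point, as a constant);
* §2 `inward`, `inward_spec`; §3 `exists_coord_eq_of_contact`, `exitDir`, `exitDir_spec`;
* §4 `pathPt`, `pathLen`, `pathFin`, `deepCtr`, `deepCtr_spec`, `φ_deepCtr_exit`, `φ_deepCtr_tan`, `φ_pathPt`, `φ_pathPt_last`, `pathPt_adj`,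
  `pathPt_mem_graphBall`; §5 `card_cylBallFin_le` (under a degree bound).
[cite: KozmaNitzan2024, §4 Lemma 10, p. 19 (Step III: x = y + e_i), p. 21 (v(P) + Λ_M, the shift of v(P) along the face), p. 26 ((29): columns)]
[cite: GrimmettPercolation1999, §7.2]
-/

noncomputable section

open scoped Classical

namespace Summit.CriticalPhenomena.PercolationContinuityZ3.Theorems.Transplant

namespace Skelφ

open Literature.Probability.Percolation Literature.Probability.LatticeModels SimpleGraph KNLevels
open Literature.Probability.Percolation.KozmaNitzan.Cells (oth oth_ne eq_oth_of_ne oth_oth)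
open Literature.Barriers.CriticalPhenomena (graphBall graphBall_finite mem_graphBall_self graphBall_mono)
open BoxProdZ2 (mem_ballFin card_ballFin_le)
open Skel (winGraph winGraph_adj KitGeom)
open SkelI (slabPt tanOff tanTgt tanTgt_mem natAbs_tanTgt_sub_le tanSign natAbs_mul_tanSign deepPt)

variable {V : Type} (G : SimpleGraph V) (φ : V → Site 2)

/-! ## §1 Straight step-walks; the column vertex over a planar point -/

/-- **The straight walk** from `v` in coordinate `i` with sign `s`: `p₀ = v`, `p_{k+1}` a neighbour of `p_k` with `φ` moved by `s e_i` when
there is one (there always is under `Steps`), else `p_k`. [cite: KozmaNitzan2024, §4 p. 21] -/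
def walk (i : Fin 2) (s : ℤˣ) (v : V) : ℕ → V
  | 0 => v
  | k + 1 =>
    if h : ∃ v' : V, G.Adj (walk i s v k) v' ∧ φ v' = φ (walk i s v k) + Pi.single i (s : ℤ) then Classical.choose h else walk i s v k

variable {G φ}

/-- Consecutive walk vertices are adjacent and `φ` moves by `s e_i` (under `Steps`). [folklore] -/
theorem walk_succ_spec (hstep : Steps G φ) (i : Fin 2) (s : ℤˣ) (v : V) (k : ℕ) :
    G.Adj (walk G φ i s v k) (walk G φ i s v (k + 1)) ∧ φ (walk G φ i s v (k + 1)) = φ (walk G φ i s v k) + Pi.single i (s : ℤ) := by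
  have h : ∃ v' : V, G.Adj (walk G φ i s v k) v' ∧ φ v' = φ (walk G φ i s v k) + Pi.single i (s : ℤ) := hstep _ i s
  have hw : walk G φ i s v (k + 1) = Classical.choose h := by
    show (if h : _ then _ else _) = _
    rw [dif_pos h]
  rw [hw]
  exact Classical.choose_spec h

/-- Consecutive walk vertices are adjacent. [folklore] -/
theorem walk_adj (hstep : Steps G φ) (i : Fin 2) (s : ℤˣ) (v : V) (k : ℕ) : G.Adj (walk G φ i s v k) (walk G φ i s v (k + 1)) :=
  (walk_succ_spec hstep i s v k).1

/-- Planar coordinates along the walk: `φ p_k = φ v + k s e_i`. [folklore] -/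
theorem φ_walk (hstep : Steps G φ) (i : Fin 2) (s : ℤˣ) (v : V) (k : ℕ) :
    φ (walk G φ i s v k) = φ v + Pi.single i ((k : ℤ) * (s : ℤ)) := by
  induction k with
  | zero => simp [walk]
  | succ k ih =>
    rw [(walk_succ_spec hstep i s v k).2, ih, add_assoc, ← Pi.single_add]
    congr 2; push_cast; ring

/-- The walk stays in the graph ball: `p_k ∈ B_G(v, k)`. [folklore] -/
theorem walk_mem_graphBall (hstep : Steps G φ) (i : Fin 2) (s : ℤˣ) (v : V) (k : ℕ) : walk G φ i s v k ∈ graphBall G v k := by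
  induction k with
  | zero => exact mem_graphBall_self G v 0
  | succ k ih => exact BoxProdZ2.mem_graphBall_succ_of_adj G ih (walk_adj hstep i s v k)

variable (G φ) in
/-- **The column vertex** over the planar point `z` seen from `v`: a vertex `g` with `φ g = z` within graph distance the planar ℓ¹-offset,
when there is one (always, under `Steps`), else `v`. [folklore] -/
def colPt (v : V) (z : Site 2) : V :=
  if h : ∃ g, g ∈ graphBall G v ((z 0 - φ v 0).natAbs + (z 1 - φ v 1).natAbs) ∧ φ g = z then Classical.choose h else v

/-- Specification of the column vertex (under `Steps`). [folklore] -/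
theorem colPt_spec (hstep : Steps G φ) (v : V) (z : Site 2) :
    colPt G φ v z ∈ graphBall G v ((z 0 - φ v 0).natAbs + (z 1 - φ v 1).natAbs) ∧ φ (colPt G φ v z) = z := by
  have h := exists_mem_graphBall_φ_eq hstep v z
  unfold colPt
  rw [dif_pos h]
  exact Classical.choose_spec h

/-! ## §2 The inward step off the boundary layer of a planar box -/

variable (G φ)

/-- **One inward step in coordinate `i`** off the boundary layer of the box `Icc Lo Hi`: from the face `φ v i = Lo i` (resp. `Hi i`) one
walk step with `φ` moved by `+e_i` (resp. `−e_i`); elsewhere `v` itself. [cite: KozmaNitzan2024, §4 p. 21 (v(P))] -/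
def inward (Lo Hi : Site 2) (i : Fin 2) (v : V) : V :=
  if φ v i = Lo i then walk G φ i 1 v 1 else if φ v i = Hi i then walk G φ i (-1) v 1 else v

variable {G φ}

/-- Specification of the inward step (box side `≥ 2` in coordinate `i`, `φ v` in the box; under `Steps`): it is `v` or a neighbour of `v`,
and its planar coordinate is `φ v` with the `i`-th entry clamped into `[Lo i + 1, Hi i − 1]`, the other entry unchanged. [folklore] -/
theorem inward_spec (hstep : Steps G φ) {Lo Hi : Site 2} (i : Fin 2) (hw : Lo i + 2 ≤ Hi i) {v : V} (hv : φ v ∈ Finset.Icc Lo Hi) :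
    (inward G φ Lo Hi i v = v ∨ G.Adj v (inward G φ Lo Hi i v)) ∧
      φ (inward G φ Lo Hi i v) i = slabPt Lo Hi 1 (φ v) i ∧ ∀ k, k ≠ i → φ (inward G φ Lo Hi i v) k = φ v k := by
  rw [Finset.mem_Icc] at hv
  have h1 : Lo i ≤ φ v i := hv.1 i
  have h2 : φ v i ≤ Hi i := hv.2 i
  unfold inward
  by_cases hlo : φ v i = Lo i
  · rw [if_pos hlo]
    obtain ⟨hadj, hφ⟩ := walk_succ_spec hstep i 1 v 0
    simp only [walk] at hadj hφ ⊢
    refine ⟨Or.inr hadj, ?_, fun k hk => ?_⟩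
    · rw [hφ]; simp only [Pi.add_apply, Pi.single_eq_same, Units.val_one, slabPt, max_def, min_def, Nat.cast_one]
      split_ifs <;> omega
    · rw [hφ]; simp [Pi.single_eq_of_ne hk]
  · rw [if_neg hlo]
    by_cases hhi : φ v i = Hi i
    · rw [if_pos hhi]
      obtain ⟨hadj, hφ⟩ := walk_succ_spec hstep i (-1) v 0
      simp only [walk] at hadj hφ ⊢
      refine ⟨Or.inr hadj, ?_, fun k hk => ?_⟩
      · rw [hφ]; simp only [Pi.add_apply, Pi.single_eq_same, Units.val_neg, Units.val_one, slabPt, max_def, min_def, Nat.cast_one]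
        split_ifs <;> omega
      · rw [hφ]; simp [Pi.single_eq_of_ne hk]
    · rw [if_neg hhi]
      refine ⟨Or.inl rfl, ?_, fun k _ => rfl⟩
      simp only [slabPt, max_def, min_def, Nat.cast_one]
      split_ifs <;> omega

/-! ## §3 Contacts: the inner neighbour sits on the boundary layer; the exit datum -/

variable (G φ)

/-- **The exit datum `(i, σ)` of a contact**: a coordinate `i` in which the inner neighbour `y` sits on a face of the box `Icc Lo Hi`, and the
outward sign `σ` of that face (`σ = 1`: `φ y i = Hi i`; `σ = -1`: `φ y i = Lo i`) — the inward normal along which the slab and the kit behind it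
are stacked (a choice; meaningful for contacts). [cite: KozmaNitzan2024, §4 p. 19 (x = y + e_i)] -/
def exitDir (w₀ : V) (R : ℕ) (Lo Hi : Site 2) (x : V) : Fin 2 × ℤˣ :=
  if h : ∃ i : Fin 2, φ (inNbr G φ w₀ R (Finset.Icc Lo Hi) x) i = Hi i then (Classical.choose h, 1)
  else if h' : ∃ i : Fin 2, φ (inNbr G φ w₀ R (Finset.Icc Lo Hi) x) i = Lo i then (Classical.choose h', -1) else (0, 1)

variable {G φ}
variable [G.LocallyFinite] [DecidableEq V]

/-- **The inner neighbour of a contact sits on the boundary layer of the box**: some coordinate of `φ y` equals `Lo i` or `Hi i` (the contact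
is outside the box and `φ` moves by at most one along the contact edge — `Lip`). [cite: KozmaNitzan2024, §4 p. 19 (x ∈ ∂B⟨j⟩)] -/
theorem exists_coord_eq_of_contact (hlip : Lip G φ) {w₀ : V} {R : ℕ} {Lo Hi : Site 2} {x : V}
    (hx : x ∈ outerBoundary (winGraph G w₀ R) (Win G φ w₀ (Finset.Icc Lo Hi) R)) :
    ∃ i : Fin 2, φ (inNbr G φ w₀ R (Finset.Icc Lo Hi) x) i = Lo i ∨ φ (inNbr G φ w₀ R (Finset.Icc Lo Hi) x) i = Hi i := by
  obtain ⟨hadj, -, hyP⟩ := inNbr_spec hx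
  have hxP : φ x ∉ Finset.Icc Lo Hi := ((mem_outerBoundary_win_iff G φ).1 hx).2.1
  by_contra hcon
  push Not at hcon
  apply hxP
  rw [Finset.mem_Icc] at hyP ⊢
  have key : ∀ i, Lo i ≤ φ x i ∧ φ x i ≤ Hi i := by
    intro i
    have h1 := hlip hadj i
    have h2 : Lo i < φ (inNbr G φ w₀ R (Finset.Icc Lo Hi) x) i := lt_of_le_of_ne (hyP.1 i) (Ne.symm (hcon i).1)
    have h3 : φ (inNbr G φ w₀ R (Finset.Icc Lo Hi) x) i < Hi i := lt_of_le_of_ne (hyP.2 i) (hcon i).2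
    rw [abs_le] at h1
    constructor <;> linarith [h1.1, h1.2]
  exact ⟨fun i => (key i).1, fun i => (key i).2⟩

/-- Specification of the exit datum of a contact: `σ = 1` and `φ y i = Hi i`, or `σ = -1` and `φ y i = Lo i`. [folklore] -/
theorem exitDir_spec (hlip : Lip G φ) {w₀ : V} {R : ℕ} {Lo Hi : Site 2} {x : V}
    (hx : x ∈ outerBoundary (winGraph G w₀ R) (Win G φ w₀ (Finset.Icc Lo Hi) R)) :
    ((exitDir G φ w₀ R Lo Hi x).2 = 1 ∧
        φ (inNbr G φ w₀ R (Finset.Icc Lo Hi) x) (exitDir G φ w₀ R Lo Hi x).1 = Hi (exitDir G φ w₀ R Lo Hi x).1) ∨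
    ((exitDir G φ w₀ R Lo Hi x).2 = -1 ∧
        φ (inNbr G φ w₀ R (Finset.Icc Lo Hi) x) (exitDir G φ w₀ R Lo Hi x).1 = Lo (exitDir G φ w₀ R Lo Hi x).1) := by
  unfold exitDir
  by_cases h : ∃ i : Fin 2, φ (inNbr G φ w₀ R (Finset.Icc Lo Hi) x) i = Hi i
  · rw [dif_pos h]
    exact Or.inl ⟨rfl, Classical.choose_spec h⟩
  · rw [dif_neg h]
    have h' : ∃ i : Fin 2, φ (inNbr G φ w₀ R (Finset.Icc Lo Hi) x) i = Lo i := by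
      obtain ⟨i, hi | hi⟩ := exists_coord_eq_of_contact hlip hx
      · exact ⟨i, hi⟩
      · exact absurd ⟨i, hi⟩ h
    rw [dif_pos h']
    exact Or.inr ⟨rfl, Classical.choose_spec h'⟩

/-! ## §4 The tangential path and the deep slab centre of a contact -/

omit [G.LocallyFinite] [DecidableEq V] in
variable (G φ) in
/-- **The near region's path** of a contact with inner neighbour `y` and exit coordinate `i₀`: `p_k = walk i₁ s (inward y) k` with `i₁ = oth i₀`,
`s` the sign of `τ − φ y i₁`, `τ` the tangential target at depth `T₀ = tanOff ℓs M`. [cite: KozmaNitzan2024, §4 p. 21] -/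
def pathPt (Lo Hi : Site 2) (ℓs M : ℕ) (i₀ : Fin 2) (y : V) (k : ℕ) : V :=
  walk G φ (oth i₀) (tanSign (tanTgt Lo Hi ℓs M (oth i₀) (φ y) - φ y (oth i₀))) (inward G φ Lo Hi i₀ y) k

omit [G.LocallyFinite] [DecidableEq V] in
variable (φ) in
/-- The number of tangential steps `K = |τ − φ y i₁|`. [folklore] -/
def pathLen (Lo Hi : Site 2) (ℓs M : ℕ) (i₀ : Fin 2) (y : V) : ℕ :=
  (tanTgt Lo Hi ℓs M (oth i₀) (φ y) - φ y (oth i₀)).natAbs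

omit [G.LocallyFinite] in
variable (G φ) in
/-- The path as a finite set `{p₀, …, p_K}`. [folklore] -/
def pathFin (Lo Hi : Site 2) (ℓs M : ℕ) (i₀ : Fin 2) (y : V) : Finset V :=
  (Finset.range (pathLen φ Lo Hi ℓs M i₀ y + 1)).image (pathPt G φ Lo Hi ℓs M i₀ y)

omit [G.LocallyFinite] [DecidableEq V] in
variable (G φ) in
/-- **The deep slab centre** of a contact `x`: the column vertex, seen from the inner neighbour `y`, over `deepPt` (exit coordinate
`φ y i₀ − σ(ℓs+1)`, tangential coordinate `τ`). [cite: KozmaNitzan2024, §4 p. 21 (v(P))] -/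
def deepCtr (w₀ : V) (R : ℕ) (Lo Hi : Site 2) (ℓs M : ℕ) (x : V) : V :=
  colPt G φ (inNbr G φ w₀ R (Finset.Icc Lo Hi) x)
    (deepPt Lo Hi ℓs M (exitDir G φ w₀ R Lo Hi x) (φ (inNbr G φ w₀ R (Finset.Icc Lo Hi) x)))

omit [G.LocallyFinite] [DecidableEq V] in
/-- Specification of the deep centre (under `Steps`; box sides `≥ 2T₀`, `φ y` in the box): within graph distance `ℓs + 1 + T₀` of `y` and
`φ (deepCtr) = deepPt`. [folklore] -/
theorem deepCtr_spec (hstep : Steps G φ) {w₀ : V} {R : ℕ} {Lo Hi : Site 2} {ℓs M : ℕ} (hw : ∀ i, Lo i + 2 * tanOff ℓs M ≤ Hi i) {x : V}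
    (hy : φ (inNbr G φ w₀ R (Finset.Icc Lo Hi) x) ∈ Finset.Icc Lo Hi) :
    deepCtr G φ w₀ R Lo Hi ℓs M x ∈ graphBall G (inNbr G φ w₀ R (Finset.Icc Lo Hi) x) (ℓs + 1 + tanOff ℓs M) ∧
      φ (deepCtr G φ w₀ R Lo Hi ℓs M x) =
        deepPt Lo Hi ℓs M (exitDir G φ w₀ R Lo Hi x) (φ (inNbr G φ w₀ R (Finset.Icc Lo Hi) x)) := by
  set y := inNbr G φ w₀ R (Finset.Icc Lo Hi) x
  have h := colPt_spec hstep y (deepPt Lo Hi ℓs M (exitDir G φ w₀ R Lo Hi x) (φ y))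
  refine ⟨graphBall_mono G y ?_ h.1, h.2⟩
  rw [Finset.mem_Icc] at hy
  -- per-coordinate distances: `ℓs + 1` in the exit coordinate, `≤ T₀` in the other
  have hc : ∀ i, (deepPt Lo Hi ℓs M (exitDir G φ w₀ R Lo Hi x) (φ y) i - φ y i).natAbs ≤
      if i = (exitDir G φ w₀ R Lo Hi x).1 then ℓs + 1 else tanOff ℓs M := by
    intro i
    by_cases hi0 : i = (exitDir G φ w₀ R Lo Hi x).1
    · rw [if_pos hi0]; simp only [deepPt, if_pos hi0]
      rcases Int.units_eq_one_or (exitDir G φ w₀ R Lo Hi x).2 with h1 | h1 <;> rw [h1] <;> push_cast <;> omega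
    · rw [if_neg hi0]; simp only [deepPt, if_neg hi0]
      exact natAbs_tanTgt_sub_le i (hw i) (hy.1 i) (hy.2 i)
  have h0 := hc 0; have h1 := hc 1
  have hne : (0 : Fin 2) ≠ 1 := by decide
  by_cases he : (exitDir G φ w₀ R Lo Hi x).1 = 0
  · rw [he] at h0 h1; rw [if_pos rfl] at h0; rw [if_neg hne.symm] at h1; omega
  · have he1 : (exitDir G φ w₀ R Lo Hi x).1 = 1 := by
      rcases Fin.eq_zero_or_eq_succ ((exitDir G φ w₀ R Lo Hi x).1) with h | ⟨k, hk⟩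
      · exact absurd h he
      · rw [hk]; exact congrArg Fin.succ (Fin.eq_zero k)
    rw [he1] at h0 h1; rw [if_neg hne] at h0; rw [if_pos rfl] at h1; omega

omit [G.LocallyFinite] [DecidableEq V] in
/-- The exit coordinate of the deep centre: `φ t i₀ = φ y i₀ − σ (ℓs + 1)`. [folklore] -/
theorem φ_deepCtr_exit (hstep : Steps G φ) {w₀ : V} {R : ℕ} {Lo Hi : Site 2} {ℓs M : ℕ} (hw : ∀ i, Lo i + 2 * tanOff ℓs M ≤ Hi i) {x : V}
    (hy : φ (inNbr G φ w₀ R (Finset.Icc Lo Hi) x) ∈ Finset.Icc Lo Hi) :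
    φ (deepCtr G φ w₀ R Lo Hi ℓs M x) (exitDir G φ w₀ R Lo Hi x).1 =
      φ (inNbr G φ w₀ R (Finset.Icc Lo Hi) x) (exitDir G φ w₀ R Lo Hi x).1 - ((exitDir G φ w₀ R Lo Hi x).2 : ℤ) * (ℓs + 1) := by
  rw [(deepCtr_spec hstep hw hy).2]; simp [deepPt]

omit [G.LocallyFinite] [DecidableEq V] in
/-- The tangential coordinate of the deep centre is the tangential target, at depth `≥ T₀`. [folklore] -/
theorem φ_deepCtr_tan (hstep : Steps G φ) {w₀ : V} {R : ℕ} {Lo Hi : Site 2} {ℓs M : ℕ} (hw : ∀ i, Lo i + 2 * tanOff ℓs M ≤ Hi i) {x : V}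
    (hy : φ (inNbr G φ w₀ R (Finset.Icc Lo Hi) x) ∈ Finset.Icc Lo Hi) :
    φ (deepCtr G φ w₀ R Lo Hi ℓs M x) (oth (exitDir G φ w₀ R Lo Hi x).1) =
      tanTgt Lo Hi ℓs M (oth (exitDir G φ w₀ R Lo Hi x).1) (φ (inNbr G φ w₀ R (Finset.Icc Lo Hi) x)) := by
  rw [(deepCtr_spec hstep hw hy).2]; simp [deepPt, oth_ne]

omit [G.LocallyFinite] [DecidableEq V] in
/-- Coordinates along the path: exit coordinate `φ y i₀ ∓ 1` (one step off the face), tangential coordinate `φ y i₁ + k s`. [folklore] -/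
theorem φ_pathPt (hstep : Steps G φ) {Lo Hi : Site 2} {ℓs M : ℕ} (i₀ : Fin 2) (hw2 : Lo i₀ + 2 ≤ Hi i₀) {y : V} (hy : φ y ∈ Finset.Icc Lo Hi)
    (k : ℕ) :
    φ (pathPt G φ Lo Hi ℓs M i₀ y k) i₀ = slabPt Lo Hi 1 (φ y) i₀ ∧
      φ (pathPt G φ Lo Hi ℓs M i₀ y k) (oth i₀) =
        φ y (oth i₀) + (k : ℤ) * (tanSign (tanTgt Lo Hi ℓs M (oth i₀) (φ y) - φ y (oth i₀)) : ℤ) := by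
  obtain ⟨-, h1, h2⟩ := inward_spec hstep i₀ hw2 hy
  unfold pathPt
  rw [φ_walk hstep]
  refine ⟨?_, ?_⟩
  · rw [Pi.add_apply, Pi.single_eq_of_ne (oth_ne i₀).symm, add_zero, h1]
  · rw [Pi.add_apply, Pi.single_eq_same, h2 _ (oth_ne i₀)]

omit [G.LocallyFinite] [DecidableEq V] in
/-- The last path vertex sits over `(φ y i₀ ∓ 1, τ)`. [folklore] -/
theorem φ_pathPt_last (hstep : Steps G φ) {Lo Hi : Site 2} {ℓs M : ℕ} (i₀ : Fin 2) (hw2 : Lo i₀ + 2 ≤ Hi i₀) {y : V}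
    (hy : φ y ∈ Finset.Icc Lo Hi) :
    φ (pathPt G φ Lo Hi ℓs M i₀ y (pathLen φ Lo Hi ℓs M i₀ y)) (oth i₀) = tanTgt Lo Hi ℓs M (oth i₀) (φ y) := by
  rw [(φ_pathPt hstep i₀ hw2 hy _).2, pathLen, natAbs_mul_tanSign]; ring

omit [G.LocallyFinite] [DecidableEq V] in
/-- Consecutive path vertices are adjacent; `p₀ = inward y`. [folklore] -/
theorem pathPt_adj (hstep : Steps G φ) (Lo Hi : Site 2) (ℓs M : ℕ) (i₀ : Fin 2) (y : V) (k : ℕ) :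
    G.Adj (pathPt G φ Lo Hi ℓs M i₀ y k) (pathPt G φ Lo Hi ℓs M i₀ y (k + 1)) :=
  walk_adj hstep _ _ _ k

omit [G.LocallyFinite] [DecidableEq V] in
/-- Path vertices are within graph distance `k + 1` of `y`. [folklore] -/
theorem pathPt_mem_graphBall (hstep : Steps G φ) {Lo Hi : Site 2} {ℓs M : ℕ} (i₀ : Fin 2) (hw2 : Lo i₀ + 2 ≤ Hi i₀) {y : V}
    (hy : φ y ∈ Finset.Icc Lo Hi) (k : ℕ) : pathPt G φ Lo Hi ℓs M i₀ y k ∈ graphBall G y (k + 1) := by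
  have h0 : inward G φ Lo Hi i₀ y ∈ graphBall G y 1 := by
    rcases (inward_spec hstep i₀ hw2 hy).1 with h | h
    · rw [h]; exact mem_graphBall_self G y 1
    · exact BoxProdZ2.mem_graphBall_succ_of_adj G (mem_graphBall_self G y 0) h
  have h := BoxProdZ2.mem_graphBall_add G h0 (walk_mem_graphBall hstep (oth i₀)
    (tanSign (tanTgt Lo Hi ℓs M (oth i₀) (φ y) - φ y (oth i₀))) (inward G φ Lo Hi i₀ y) k)
  unfold pathPt
  exact graphBall_mono G y (by omega) h

/-! ## §5 Sizes of cylinder balls under a degree bound -/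

omit [DecidableEq V] in
/-- Cylinder balls have at most `(Δ+1)^{R'}` vertices (they lie in the graph ball of radius `R'`). [folklore] -/
theorem card_cylBallFin_le {Δ : ℕ} (hΔ : ∀ v, G.degree v ≤ Δ) (t : V) (ℓ R' : ℕ) : (cylBallFin G φ t ℓ R').card ≤ (Δ + 1) ^ R' := by
  classical
  refine le_trans (Finset.card_le_card fun v hv => ?_) (card_ballFin_le G hΔ t R')
  rw [mem_cylBallFin] at hv
  exact (mem_ballFin G).2 (cylBall_subset_prism G φ t ℓ R' hv).1

end Skelφ

end Summit.CriticalPhenomena.PercolationContinuityZ3.Theorems.Transplant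

end
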